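import Mathlib
import HarnessLib
import Summits.NavierStokesRegularity.NavierStokesRegularity.Theorems.AxisTwistDoorAveragedConeLiouvilleDefs
import Summits.NavierStokesRegularity.NavierStokesRegularity.Theorems.AxisTwistDoorAveragedConeLiouvillePositivityDensity
import Summits.NavierStokesRegularity.NavierStokesRegularity.Theorems.AxisTwistDoorAveragedConeLiouvillePositivityCover
import Summits.NavierStokesRegularity.NavierStokesRegularity.Theorems.AxisTwistDoorAveragedConeLiouvillePositivityChain

/-!
# Route `AxisTwistDoor`, crux `AveragedConeLiouville` (stmt-NavierStokesRegularity-26889), line `lrt_shell` —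
# `PositivityPropagationFactC` HOLDS: the classical positivity propagation, proved without Nazarov–Ural'tseva

`positivityPropagationFactC_holds : PositivityPropagationFactC` (Defs): for `δ, T > 0`, `0 < r < 1`, `Λ ≥ 0` there
is `β = β(δ,T,r,Λ) > 0` such that every `C²` function `V ≥ 0` on a neighbourhood of the closed unit cylinder
`[0,T] × B̄(0,1) ⊂ ℝ × ℝ³` with `∂ₜV − ΔV + ⟪b, ∇V⟫ ≥ 0` for a `C¹` drift `|b| ≤ Λ`, and with
`|{x ∈ B(1) : V(t̄,x) ≥ λ}| ≥ δ` for some `t̄ ∈ (0, T/3)`, `λ > 0`, satisfies `V ≥ βλ` on `(T/2, T) × B(0, r)`.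

This is the statement through which the line `lrt_shell` consumed the literature fact
`Literature.Analysis.FluidPDE.NazarovUraltseva2011_positivity_propagation` (Nazarov–Ural'tseva 2011 Cor. 3.2 =
Lei–Ren–Tian arXiv:2501.08976 Lemma 2.5; bridge `stub_positivityOfNU`).  For CLASSICAL supersolutions and BOUNDED
drifts it is elementary — comparison with caloric barriers, no De Giorgi–Nash–Moser theory, and `div b = 0` is not
even used:

1. (brick P4 `exists_dense_ball`) after discarding a thin boundary layer, the superlevel set `E` has density `≳ δ` in
   some ball `B̄(q, h)`, `h = h(δ,T,r,Λ)` a small parabolic scale;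
2. (brick P3 `density_step`, on P1 `barrier_comparison` + P2) comparison with `λ (e^{(t−t̄)Δ}g − m − A√(t−t̄))`,
   `g = χ·min(1, V(t̄,·)/λ) ≤ V(t̄,·)/λ`, `g = 1` on `E ∩ B̄(q,h)`, gives `V(t̄ + 4h²) ≥ 2γλ` on `B̄(q, 4h)`,
   `γ = γ(δ) > 0`, once `16Λh ≤ γ` (the drift is perturbative at small scales);
3. (brick P5 `chain`, on P2 `spread_step`) a chain of `n ≤ T/h²` small parabolic steps along the segment from `q` to
   any `x ∈ B(0,r)`, timed to arrive exactly at any `t ∈ (T/2, T)`, each costing a universal factor `c⋆`: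
   `V(t,x) ≥ 2γ c⋆^{⌈T/h²⌉} λ`.

Consequence for the crux (next file): the closing theorem of 26889 needs Lei–Ren 2024 ONLY.

Seat ns-atd-p1 (LEAD g2).  WHAT THIS IS NOT: not a statement about Navier–Stokes regularity; a linear parabolic
lemma serving a STAGED door route; the crux `AveragedConeLiouville` stays conditional on Lei–Ren's quantitative
regular shells, and the leaf / NS regularity are OPEN.
-/

noncomputable section

-- the summit and its single sub-problem share the name (CONVENTIONS §1), as in every Theorems file
set_option linter.dupNamespace false

namespace Summit.NavierStokesRegularity.NavierStokesRegularity.Theorems.AveragedConeLiouville.PositivityFactC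

open scoped InnerProductSpace ENNReal Laplacian Topology NNReal
open Set Function MeasureTheory Metric Filter Real
open Summit.NavierStokesRegularity.NavierStokesRegularity.Theorems.AxisTwistDoorAveragedConeLiouvilleDefs
open Summit.NavierStokesRegularity.NavierStokesRegularity.Theorems.AveragedConeLiouville.PositivityDensity
open Summit.NavierStokesRegularity.NavierStokesRegularity.Theorems.AveragedConeLiouville.PositivityCover
open Summit.NavierStokesRegularity.NavierStokesRegularity.Theorems.AveragedConeLiouville.PositivityChain

/-! ### Measure-theoretic preliminaries -/

/-- The superlevel set `{x ∈ B(0,1) : λ ≤ V x}` of a function continuous on `B̄(0,1)` is measurable. -/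
theorem measurableSet_superlevel {V : EuclideanSpace ℝ (Fin 3) → ℝ}
    (hV : ContinuousOn V (closedBall (0 : EuclideanSpace ℝ (Fin 3)) 1)) (lam : ℝ) :
    MeasurableSet {x : EuclideanSpace ℝ (Fin 3) | x ∈ ball (0 : EuclideanSpace ℝ (Fin 3)) 1 ∧ lam ≤ V x} := by
  have hclosed : IsClosed (closedBall (0 : EuclideanSpace ℝ (Fin 3)) 1 ∩ V ⁻¹' Ici lam) :=
    hV.preimage_isClosed_of_isClosed isClosed_closedBall isClosed_Ici
  have heq : {x : EuclideanSpace ℝ (Fin 3) | x ∈ ball (0 : EuclideanSpace ℝ (Fin 3)) 1 ∧ lam ≤ V x} =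
      ball 0 1 ∩ (closedBall (0 : EuclideanSpace ℝ (Fin 3)) 1 ∩ V ⁻¹' Ici lam) := by
    ext x
    simp only [mem_setOf_eq, mem_inter_iff, mem_preimage, mem_Ici]
    exact ⟨fun h => ⟨h.1, ball_subset_closedBall h.1, h.2⟩, fun h => ⟨h.1, h.2.2⟩⟩
  rw [heq]
  exact measurableSet_ball.inter hclosed.measurableSet

/-- The volume of the spherical layer `B(0,1) ∖ B(0,ρ)`, `0 ≤ ρ ≤ 1`, is at most `4π(1 − ρ)`. -/
theorem volume_real_layer_le {ρ : ℝ} (hρ0 : 0 ≤ ρ) (hρ1 : ρ ≤ 1) :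
    volume.real (ball (0 : EuclideanSpace ℝ (Fin 3)) 1 \ ball 0 ρ) ≤ 4 * π * (1 - ρ) := by
  rw [measureReal_sdiff (ball_subset_ball hρ1) measurableSet_ball]
  simp only [Measure.real, EuclideanSpace.volume_ball_fin_three, ENNReal.toReal_mul, ENNReal.toReal_pow,
    ENNReal.toReal_ofReal zero_le_one, ENNReal.toReal_ofReal hρ0,
    ENNReal.toReal_ofReal (show (0 : ℝ) ≤ π * 4 / 3 by positivity)]
  have h0 : 0 ≤ (1 - ρ) ^ 2 * (2 + ρ) := by positivity
  have h1 : 1 - ρ ^ 3 ≤ 3 * (1 - ρ) := by nlinarith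
  nlinarith [Real.pi_pos]

/-- **Step 1 — a dense small ball.**  If `V` is continuous on `B̄(0,1)` and `|{x ∈ B(1) : V x ≥ λ}| ≥ δ > 0`, then for a
scale `0 < h ≤ 1` and a margin factor `M ≥ 0` with `hM ≤ 1/2` and `4π hM ≤ δ/2`, there are a point `q` with
`‖q‖ ≤ 1 − hM + h` and a measurable `E'' ⊆ B̄(q, h)`, contained in that superlevel set, of measure `≥ δh³/1458`
(discard the layer `B(1) ∖ B(1 − hM)`, of volume `≤ δ/2`, then pigeonhole over the grid, brick P4). -/
theorem exists_dense_piece {V : EuclideanSpace ℝ (Fin 3) → ℝ}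
    (hV : ContinuousOn V (closedBall (0 : EuclideanSpace ℝ (Fin 3)) 1)) {δ lam h M : ℝ}
    (hh0 : 0 < h) (hh1 : h ≤ 1) (hM0 : 0 ≤ M) (hM : h * M ≤ 1 / 2) (hlayer : 4 * π * (h * M) ≤ δ / 2)
    (hmeas : ENNReal.ofReal δ ≤
      volume {x : EuclideanSpace ℝ (Fin 3) | x ∈ ball (0 : EuclideanSpace ℝ (Fin 3)) 1 ∧ lam ≤ V x}) :
    ∃ (q : EuclideanSpace ℝ (Fin 3)) (E'' : Set (EuclideanSpace ℝ (Fin 3))), ‖q‖ ≤ 1 - h * M + h ∧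
      MeasurableSet E'' ∧ E'' ⊆ closedBall q h ∧
      (∀ y ∈ E'', y ∈ ball (0 : EuclideanSpace ℝ (Fin 3)) 1 ∧ lam ≤ V y) ∧
      ENNReal.ofReal (δ * h ^ 3 / 1458) ≤ volume E'' := by
  -- the superlevel set
  obtain ⟨E, hE⟩ : ∃ E : Set (EuclideanSpace ℝ (Fin 3)),
      E = {x | x ∈ ball (0 : EuclideanSpace ℝ (Fin 3)) 1 ∧ lam ≤ V x} := ⟨_, rfl⟩
  rw [← hE] at hmeas
  have hEsub1 : E ⊆ ball 0 1 := fun y hy => by rw [hE] at hy; exact hy.1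
  have hEm : MeasurableSet E := by rw [hE]; exact measurableSet_superlevel hV lam
  have hfin1 : volume (ball (0 : EuclideanSpace ℝ (Fin 3)) 1) ≠ ⊤ := by
    rw [EuclideanSpace.volume_ball_fin_three]
    exact ENNReal.mul_ne_top (ENNReal.pow_ne_top ENNReal.ofReal_ne_top) ENNReal.ofReal_ne_top
  have hEfin : volume E ≠ ⊤ := ne_top_of_le_ne_top hfin1 (measure_mono hEsub1)
  have hEδ : δ ≤ volume.real E := (ENNReal.ofReal_le_iff_le_toReal hEfin).1 hmeas
  -- discard the boundary layer
  obtain ⟨ρ, hρ⟩ : ∃ ρ : ℝ, ρ = 1 - h * M := ⟨_, rfl⟩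
  have hρ0 : 0 < ρ := by rw [hρ]; linarith
  have hρ1 : ρ ≤ 1 := by rw [hρ]; have := mul_nonneg hh0.le hM0; linarith
  have hE'fin : volume (E ∩ ball 0 ρ) ≠ ⊤ := ne_top_of_le_ne_top hEfin (measure_mono inter_subset_left)
  have hE'δ : δ / 2 ≤ volume.real (E ∩ ball 0 ρ) := by
    have h1 : volume.real E ≤ volume.real (E ∩ ball 0 ρ) + volume.real (E \ ball 0 ρ) := by
      have := measureReal_union_le (μ := volume) (E ∩ ball 0 ρ) (E \ ball 0 ρ)
      rwa [inter_union_sdiff] at this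
    have h2 : volume.real (E \ ball 0 ρ) ≤ volume.real (ball (0 : EuclideanSpace ℝ (Fin 3)) 1 \ ball 0 ρ) :=
      measureReal_mono (sdiff_subset_sdiff_left hEsub1) (ne_top_of_le_ne_top hfin1 (measure_mono sdiff_subset))
    have h3 := volume_real_layer_le hρ0.le hρ1
    have h4 : 4 * π * (1 - ρ) ≤ δ / 2 := by rw [hρ]; simpa using hlayer
    linarith
  -- pigeonhole
  obtain ⟨q, hq, hqE⟩ := exists_dense_ball (E := E ∩ ball 0 ρ) hρ0 hh0 inter_subset_right
  have hE''fin : volume (E ∩ ball 0 ρ ∩ closedBall q h) ≠ ⊤ :=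
    ne_top_of_le_ne_top hE'fin (measure_mono inter_subset_left)
  refine ⟨q, E ∩ ball 0 ρ ∩ closedBall q h, by rw [hρ] at hq; exact hq,
    (hEm.inter measurableSet_ball).inter measurableSet_closedBall, inter_subset_right,
    fun y hy => by have := hy.1.1; rw [hE] at this; exact this, ?_⟩
  rw [ENNReal.ofReal_le_iff_le_toReal hE''fin]
  have h1 : volume.real (E ∩ ball 0 ρ) ≤ (4 * ρ / h + 5) ^ 3 * volume.real (E ∩ ball 0 ρ ∩ closedBall q h) := by
    have := ENNReal.toReal_mono (ENNReal.mul_ne_top ENNReal.ofReal_ne_top hE''fin) hqE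
    rwa [ENNReal.toReal_mul, ENNReal.toReal_ofReal (by positivity)] at this
  have h2 : (4 * ρ / h + 5) ^ 3 ≤ (9 / h) ^ 3 := by
    refine pow_le_pow_left₀ (by positivity) ?_ 3
    rw [div_add' _ _ _ hh0.ne', div_le_div_iff_of_pos_right hh0]
    linarith
  have h3 : volume.real (E ∩ ball 0 ρ) ≤ (9 / h) ^ 3 * volume.real (E ∩ ball 0 ρ ∩ closedBall q h) :=
    h1.trans (mul_le_mul_of_nonneg_right h2 measureReal_nonneg)
  have h4 : δ / 2 ≤ (9 / h) ^ 3 * volume.real (E ∩ ball 0 ρ ∩ closedBall q h) := hE'δ.trans h3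
  have h5 : (9 / h) ^ 3 = 729 / h ^ 3 := by rw [div_pow]; norm_num
  rw [h5, div_mul_eq_mul_div, le_div_iff₀ (by positivity)] at h4
  show δ * h ^ 3 / 1458 ≤ volume.real (E ∩ ball 0 ρ ∩ closedBall q h)
  rw [div_le_iff₀ (by norm_num : (0:ℝ) < 1458)]
  linarith

/-! ### The theorem -/

/-- **The classical positivity propagation holds** (`PositivityPropagationFactC` of the Defs file, hitherto taken
from Nazarov–Ural'tseva 2011 via `stub_positivityOfNU`): proved by comparison with caloric barriers — dense small
ball by pigeonhole (P4), one perturbative comparison step (P3 on P1–P2), and a Harnack chain of small parabolic steps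
(P5). -/
theorem positivityPropagationFactC_holds : PositivityPropagationFactC := by
  intro δ T r Λ hδ hT hr hr1 hΛ
  obtain ⟨c₁, C₂, hc₁, hC₂, hdens⟩ := density_step
  obtain ⟨cstar, Nstar, hcs0, hcs1, hN3, hchain⟩ := chain
  ---------------------------------------------------------------- constants
  -- the gain of the density step: `c₁ (2h)⁻³ · (δ h³/1458) = c₁ δ / 11664 = 4γ`
  obtain ⟨γ, hγ0, hγ⟩ : ∃ γ : ℝ, 0 < γ ∧ c₁ * δ / 46656 = γ := ⟨_, by positivity, rfl⟩
  -- the ratio `N' = R/(2h)` of the density step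
  obtain ⟨N', hN'N, hN'3, hN'C⟩ : ∃ N' : ℝ, Nstar ≤ N' ∧ 3 ≤ N' ∧ C₂ / γ ≤ N' - 1 := by
    refine ⟨max Nstar (1 + C₂ / γ), le_max_left _ _, le_trans hN3 (le_max_left _ _), ?_⟩
    have := le_max_right Nstar (1 + C₂ / γ); linarith
  have hNs0 : 0 < Nstar := by linarith
  have hN'0 : 0 < N' := by linarith
  -- the scale `h = h(δ, T, r, Λ)`
  obtain ⟨h, hh0, hh1, hhT, hhr, hhN, hhδ, hhγ, hhc⟩ : ∃ h : ℝ, 0 < h ∧ h ≤ 1 ∧ h ≤ T / 48 ∧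
      h ≤ (1 - r) / (2 * Nstar) ∧ h ≤ 1 / (4 * N' + 4) ∧ h ≤ δ / (8 * π * (2 * N' + 2)) ∧
      h ≤ γ / (16 * Λ + 1) ∧ h ≤ cstar / (8 * Λ + 1) := by
    refine ⟨min (min (min 1 (T / 48)) (min ((1 - r) / (2 * Nstar)) (1 / (4 * N' + 4))))
      (min (δ / (8 * π * (2 * N' + 2))) (min (γ / (16 * Λ + 1)) (cstar / (8 * Λ + 1)))), ?_, ?_, ?_, ?_, ?_, ?_, ?_, ?_⟩
    · refine lt_min (lt_min (lt_min one_pos (by positivity)) (lt_min ?_ (by positivity)))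
        (lt_min (by positivity) (lt_min (by positivity) (by positivity)))
      exact div_pos (by linarith) (by positivity)
    · exact le_trans (min_le_left _ _) (le_trans (min_le_left _ _) (min_le_left _ _))
    · exact le_trans (min_le_left _ _) (le_trans (min_le_left _ _) (min_le_right _ _))
    · exact le_trans (min_le_left _ _) (le_trans (min_le_right _ _) (min_le_left _ _))
    · exact le_trans (min_le_left _ _) (le_trans (min_le_right _ _) (min_le_right _ _))
    · exact le_trans (min_le_right _ _) (min_le_left _ _)
    · exact le_trans (min_le_right _ _) (le_trans (min_le_right _ _) (min_le_left _ _))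
    · exact le_trans (min_le_right _ _) (le_trans (min_le_right _ _) (min_le_right _ _))
  -- derived inequalities
  have hΛγ : 16 * Λ * h ≤ γ := by
    have h1 : 16 * Λ * h ≤ 16 * Λ * (γ / (16 * Λ + 1)) := mul_le_mul_of_nonneg_left hhγ (by positivity)
    have h2 : 16 * Λ * (γ / (16 * Λ + 1)) ≤ γ := by
      rw [mul_div_assoc', div_le_iff₀ (by positivity)]; nlinarith
    linarith
  have hΛc : 8 * Λ * h ≤ cstar := by
    have h1 : 8 * Λ * h ≤ 8 * Λ * (cstar / (8 * Λ + 1)) := mul_le_mul_of_nonneg_left hhc (by positivity)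
    have h2 : 8 * Λ * (cstar / (8 * Λ + 1)) ≤ cstar := by
      rw [mul_div_assoc', div_le_iff₀ (by positivity)]; nlinarith
    linarith
  have hmargin : h * (2 * N' + 2) ≤ 1 / 2 := by
    have := (le_div_iff₀ (by positivity : (0:ℝ) < 4 * N' + 4)).1 hhN
    linarith
  have hlayer : 4 * π * (h * (2 * N' + 2)) ≤ δ / 2 := by
    have h1 := (le_div_iff₀ (by positivity : (0:ℝ) < 8 * π * (2 * N' + 2))).1 hhδ
    have h2 : 4 * π * (h * (2 * N' + 2)) = (h * (8 * π * (2 * N' + 2))) / 2 := by ring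
    rw [h2]; linarith
  have hNsh : Nstar * h ≤ (1 - r) / 2 := by
    have h1 := (le_div_iff₀ (by positivity : (0:ℝ) < 2 * Nstar)).1 hhr
    have h2 : Nstar * h = (h * (2 * Nstar)) / 2 := by ring
    rw [h2]; linarith
  have hh2 : h ^ 2 ≤ h := by
    have : h ^ 2 = h * h := sq h
    rw [this]; exact mul_le_of_le_one_right hh0.le hh1
  -- `β = 2γ c⋆^{⌈T/h²⌉}`
  refine ⟨2 * γ * cstar ^ ⌈T / h ^ 2⌉₊, by positivity, ?_⟩
  intro V b U hU hUsub hV _hb1 hb _hdiv hV0 hsup tbar lam htbar htbarT hlam hmeas t ht x hx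
  ---------------------------------------------------------------- step 1: a dense small ball
  have htbarI : tbar ∈ Icc 0 T := ⟨htbar.le, by linarith⟩
  have hVtbar : ContinuousOn (V tbar) (closedBall (0 : EuclideanSpace ℝ (Fin 3)) 1) := by
    have hmaps : MapsTo (fun y : EuclideanSpace ℝ (Fin 3) => (tbar, y)) (closedBall 0 1) U :=
      fun y hy => hUsub ⟨htbarI, hy⟩
    have h1 : ContinuousOn (fun y : EuclideanSpace ℝ (Fin 3) => (tbar, y)) (closedBall 0 1) := by fun_prop
    exact hV.continuousOn.comp h1 hmaps
  obtain ⟨q, E'', hq, hE''m, hE''sub, hE''V, hηE⟩ :=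
    exists_dense_piece hVtbar hh0 hh1 (by positivity : (0:ℝ) ≤ 2 * N' + 2) hmargin hlayer hmeas
  ---------------------------------------------------------------- step 2: the density step
  obtain ⟨R, hR⟩ : ∃ R : ℝ, R = 2 * h * N' := ⟨_, rfl⟩
  have hR4 : 4 * h < R := by
    rw [hR]
    have := mul_le_mul_of_nonneg_left hN'3 (by positivity : (0:ℝ) ≤ 2 * h)
    linarith
  have ht14 : tbar + 4 * h ^ 2 < T := by linarith
  -- the cylinder `[tbar, tbar + 4h²] × B̄(q, R)` inside the unit cylinder
  have hqR : ∀ y ∈ closedBall q R, y ∈ ball (0 : EuclideanSpace ℝ (Fin 3)) 1 := by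
    intro y hy
    rw [mem_ball_zero_iff]
    calc ‖y‖ = dist y 0 := (dist_zero_right _).symm
      _ ≤ dist y q + dist q 0 := dist_triangle _ _ _
      _ ≤ R + (1 - h * (2 * N' + 2) + h) :=
        add_le_add (mem_closedBall.1 hy) (by rw [dist_zero_right]; exact hq)
      _ = 1 - h := by rw [hR]; ring
      _ < 1 := by linarith
  have hW1 : Icc tbar (tbar + 4 * h ^ 2) ×ˢ closedBall q R ⊆ U := by
    rintro ⟨s, y⟩ ⟨hs, hy⟩
    exact hUsub ⟨⟨le_trans htbar.le hs.1, le_trans hs.2 ht14.le⟩, ball_subset_closedBall (hqR y hy)⟩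
  have hIoc1 : ∀ s ∈ Ioc tbar (tbar + 4 * h ^ 2), s ∈ Ioo 0 T :=
    fun s hs => ⟨lt_trans htbar hs.1, lt_of_le_of_lt hs.2 ht14⟩
  have hIcc1 : ∀ s ∈ Icc tbar (tbar + 4 * h ^ 2), s ∈ Ioo 0 T :=
    fun s hs => ⟨lt_of_lt_of_le htbar hs.1, lt_of_le_of_lt hs.2 ht14⟩
  have hb1 : ∀ s ∈ Ioc tbar (tbar + 4 * h ^ 2), ∀ y ∈ ball q R, ‖b s y‖ ≤ Λ :=
    fun s hs y hy => hb s (hIoc1 s hs) y (hqR y (ball_subset_closedBall hy))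
  have hV01 : ∀ s ∈ Icc tbar (tbar + 4 * h ^ 2), ∀ y ∈ closedBall q R, 0 ≤ V s y :=
    fun s hs y hy => hV0 s (hIcc1 s hs) y (hqR y hy)
  have hsup1 : ∀ s ∈ Ioc tbar (tbar + 4 * h ^ 2), ∀ y ∈ ball q R,
      0 ≤ deriv (fun σ => V σ y) s - (Δ (V s)) y + ⟪b s y, gradient (V s) y⟫_ℝ :=
    fun s hs y hy => hsup s (hIoc1 s hs) y (hqR y (ball_subset_closedBall hy))
  have hEV : ∀ y ∈ E'', lam ≤ V tbar y := fun y hy => (hE''V y hy).2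
  have h48 : 4 * h ^ 2 ≤ 8 * h ^ 2 := by nlinarith
  have hstep1 := hdens V b U q tbar (4 * h ^ 2) h R Λ lam (δ * h ^ 3 / 1458) E'' hU hW1 hV hΛ hb1 hV01 hsup1
    hh0 hR4 le_rfl h48 hlam hE''m hE''sub hEV (by positivity) hηE
  -- bookkeeping of the three terms: `4γ − γ − γ`
  have hgain : c₁ / (2 * h) ^ 3 * (δ * h ^ 3 / 1458) = 4 * γ := by
    rw [← hγ]; field_simp; ring
  have hratio : C₂ * (2 * h / (R - 2 * h)) ^ 3 ≤ γ := by
    have hN1 : 0 < N' - 1 := by linarith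
    have hq' : 2 * h / (R - 2 * h) = 1 / (N' - 1) := by
      rw [hR, show 2 * h * N' - 2 * h = (2 * h) * (N' - 1) by ring]
      field_simp
    rw [hq']
    have hle1 : (1 / (N' - 1)) ^ 3 ≤ 1 / (N' - 1) := by
      have h01 : 0 ≤ 1 / (N' - 1) := by positivity
      have h11 : 1 / (N' - 1) ≤ 1 := by rw [div_le_one hN1]; linarith
      calc (1 / (N' - 1)) ^ 3 = (1 / (N' - 1)) * ((1 / (N' - 1)) * (1 / (N' - 1))) := by ring
        _ ≤ (1 / (N' - 1)) * (1 * 1) :=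
          mul_le_mul_of_nonneg_left (mul_le_mul h11 h11 h01 zero_le_one) h01
        _ = 1 / (N' - 1) := by ring
    have hC : C₂ * (1 / (N' - 1)) ≤ γ := by
      rw [mul_one_div, div_le_iff₀ hN1]
      have := (div_le_iff₀ hγ0).1 hN'C
      linarith
    exact le_trans (mul_le_mul_of_nonneg_left hle1 hC₂) hC
  have hball1 : ∀ y ∈ closedBall q (4 * h), 2 * γ * lam ≤ V (tbar + 4 * h ^ 2) y := by
    intro y hy
    have h1 := hstep1 y hy
    rw [hgain] at h1
    have h2 : lam * (2 * γ) ≤ lam * (4 * γ - C₂ * (2 * h / (R - 2 * h)) ^ 3 - 16 * Λ * h) :=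
      mul_le_mul_of_nonneg_left (by linarith) hlam.le
    linarith
  ---------------------------------------------------------------- step 3: the chain to `(t, x)`
  obtain ⟨t₁, ht₁⟩ : ∃ t₁ : ℝ, t₁ = tbar + 4 * h ^ 2 := ⟨_, rfl⟩
  rw [← ht₁] at hball1
  have ht₁0 : 0 < t₁ := by rw [ht₁]; positivity
  obtain ⟨D, hD⟩ : ∃ D : ℝ, D = t - t₁ := ⟨_, rfl⟩
  have hD1 : 2 * h + 2 * h ^ 2 ≤ D := by
    rw [hD, ht₁]
    linarith [ht.1]
  have hDT : D ≤ T := by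
    rw [hD, ht₁]
    have := sq_nonneg h
    linarith [ht.2]
  obtain ⟨n, hn1, hτ1, hτ2, hn2, hnD⟩ := exists_nat_steps hh0 hD1
  have hn0 : n ≠ 0 := by omega
  have hn0' : (n : ℝ) ≠ 0 := Nat.cast_ne_zero.2 hn0
  obtain ⟨p, hp⟩ : ∃ p : ℕ → EuclideanSpace ℝ (Fin 3), ∀ i : ℕ, p i = q + ((i : ℝ) / (n : ℝ)) • (x - q) :=
    ⟨fun i => q + ((i : ℝ) / (n : ℝ)) • (x - q), fun i => rfl⟩
  -- the balls of the chain lie in the unit ball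
  have hxn : ‖x‖ < r := by simpa using hx
  have hballs : ∀ i ≤ n, closedBall (p i) (Nstar * h) ⊆ ball (0 : EuclideanSpace ℝ (Fin 3)) 1 := by
    intro i hi y hy
    rw [mem_ball_zero_iff]
    have h1 : ‖p i‖ ≤ max ‖q‖ ‖x‖ := by rw [hp]; exact norm_segment_point_le q x hn0 hi
    have h2 : max ‖q‖ ‖x‖ + Nstar * h < 1 := by
      rcases le_total ‖q‖ ‖x‖ with hqx | hqx
      · rw [max_eq_right hqx]; linarith
      · rw [max_eq_left hqx]
        have h3 : Nstar * h ≤ N' * h := mul_le_mul_of_nonneg_right hN'N hh0.le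
        have h4 : 0 ≤ N' * h := by positivity
        have h5 : 1 - h * (2 * N' + 2) + h + Nstar * h ≤ 1 - h := by linarith
        linarith
    calc ‖y‖ = dist y 0 := (dist_zero_right _).symm
      _ ≤ dist y (p i) + dist (p i) 0 := dist_triangle _ _ _
      _ ≤ Nstar * h + ‖p i‖ := add_le_add (mem_closedBall.1 hy) (by rw [dist_zero_right])
      _ < 1 := by linarith
  have hdist : ∀ i < n, dist (p (i + 1)) (p i) ≤ h := by
    intro i _
    have h1 : dist (p (i + 1)) (p i) = ‖x - q‖ / n := by
      rw [hp, hp]; exact dist_segment_point_succ q x n i hn0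
    rw [h1]
    have h2 : ‖x - q‖ ≤ 2 := by
      calc ‖x - q‖ ≤ ‖x‖ + ‖q‖ := norm_sub_le _ _
        _ ≤ 1 + 1 := add_le_add (by linarith) (by linarith)
        _ = 2 := by norm_num
    calc ‖x - q‖ / n ≤ 2 / n := div_le_div_of_nonneg_right h2 (Nat.cast_nonneg _)
      _ ≤ h := hn2
  have htime : t₁ + n * (D / n) = t := by rw [mul_div_cancel₀ _ hn0', hD]; ring
  have htT : t₁ + n * (D / n) < T := by rw [htime]; exact ht.2
  have hinit : ∀ y ∈ closedBall (p 0) h, 2 * γ * lam ≤ V t₁ y := by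
    intro y hy
    have hp0 : p 0 = q := by rw [hp, Nat.cast_zero, zero_div, zero_smul, add_zero]
    rw [hp0] at hy
    exact hball1 y (closedBall_subset_closedBall (by linarith) hy)
  have hpn : p n = x := by rw [hp, div_self hn0', one_smul]; abel
  have hend := hchain V b U T Λ h (D / n) (2 * γ * lam) t₁ p n hU hUsub hV hΛ hb hV0 hsup hh0 hΛc hτ1 hτ2
    (by positivity) ht₁0 htT hballs hdist hinit x (by rw [hpn]; exact mem_closedBall_self hh0.le)
  rw [htime] at hend
  -- `c⋆^{⌈T/h²⌉} ≤ c⋆ⁿ`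
  have hnN : n ≤ ⌈T / h ^ 2⌉₊ := by
    have h1 : (n : ℝ) ≤ T / h ^ 2 := hnD.trans (div_le_div_of_nonneg_right hDT (by positivity))
    have h2 : (n : ℝ) ≤ (⌈T / h ^ 2⌉₊ : ℝ) := h1.trans (Nat.le_ceil _)
    exact_mod_cast h2
  have hpow : cstar ^ ⌈T / h ^ 2⌉₊ ≤ cstar ^ n := pow_le_pow_of_le_one hcs0.le hcs1.le hnN
  have hfin : 2 * γ * cstar ^ ⌈T / h ^ 2⌉₊ * lam ≤ 2 * γ * cstar ^ n * lam := by
    have := mul_le_mul_of_nonneg_left hpow (by positivity : (0:ℝ) ≤ 2 * γ * lam)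
    linarith
  calc 2 * γ * cstar ^ ⌈T / h ^ 2⌉₊ * lam ≤ 2 * γ * cstar ^ n * lam := hfin
    _ = cstar ^ n * (2 * γ * lam) := by ring
    _ ≤ V t x := hend

/-- Registered stub (4) of the skeleton of record `lrt_shell` v8 of crux stmt-NavierStokesRegularity-26889, BY NAME:
the classical positivity propagation holds. -/
theorem stub_positivityFactC : PositivityPropagationFactC := positivityPropagationFactC_holds

end Summit.NavierStokesRegularity.NavierStokesRegularity.Theorems.AveragedConeLiouville.PositivityFactC

end
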